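import Summits.HodgeConjecture.HodgeConjecture.Theorems.F0P3SpectralPacketSatake        -- ★ (N) FILE 3j p843140 (this seat): Satake at the tuple (+ ★ 3i, 3h, 3f `trSψ` `evpGψ`, 3d `tr`, 3a, 2b, 1; ★ `TestS₀`, `tens₀`, `toPureTensor`, `locAll`, `Unr₀`)
import Summits.HodgeConjecture.HodgeConjecture.Theorems.F0P3SpectralPacketTraceIndep    -- ★ (N) FILE 3d′ p842437: `SpectralPacketG.loc_ofUnramified_of_isUnramified` (+ ★ 3d `tr_eq_prod_of_subset`, `exists_isTestPresentation`)
import HarnessLib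

/-!
# (N) DEFS, FILE 3k — THE PACKET-FACTORISATION CLAUSE (P1)-G OF `K9SpectralLetter` AT THE TUPLE, REDUCED TO THE ARCHIMEDEAN INNER-TRANSFER CHARACTER IDENTITY:
# `Tr Π(f_S ⊗ f^S) = Tr Π_{S,∞}(f′_{S,∞}) · ∏_{v ∉ S} vol(K′_v)·t(Π)_v(f^S_v)` for the pinned partner `f` of `f′ = f′_{S,∞} ⊗ f^S` (Rogawski §14.6 p. 243, §13.7 p. 206, §14.2 pp. 232–233; Flath Thm. 3)

Cell `hodgecm-mathlib` (D-0151), F0∕P3 «U3-mult», crux H413 (`stmt-HodgeConjecture-24833`), route of record `HCCMUnconditional`.  (N) lead pen F0P3a-p01 (g12); SPEC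
`F0/P3a/F0P3a-p01/g12/SPEC-K9STF-junction-at-tuple.F0P3a-p01g12.md` 71fff7a5 §J5.1; LEAD F0P3a-plan (g10).  PROOF lane (`--kind proof --supports stmt-HodgeConjecture-24833
--as helper`): theorems only; no `def`, no instance, no notation, no named fact, no `sorry`; never imports a `Cruxes/…/Lines` module (the kit `𝔨` enters only through its
`ψ` and the pin (ix′) RELATION `T′.loc v = T.loc v ∘ ψ_v⁻¹` between the record tensor `T = toPureTensor S fS fT` and its `G`-side partner `T′`, taken as a hypothesis).
HONEST LABEL: HC_CM is proved only modulo the printed citations until rung 0 closes; this file reduces (P1)-G at the (N) tuple to ONE archimedean identity — «`Tr Π_∞` of the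
archimedean inner transfer `f_∞` of `f′_∞`, read with the `U(2,1)`-characters `archTrG`, equals `Tr Π_∞(f′_∞)` read with the compact-side characters `archTr₀`» (letter N8 at the
packet classes) — modulo (TF-1), (TF-ind) (★ 3d′: a theorem under admissibility), (ℓ4), member admissibility, the Gelfand bound and the pin's level clause off `S₀ ⊆ S`.

THE MATHEMATICS.  The partner `f = T′.eval` is a smooth pure tensor, so `Tr Π(f) = Tr Π_∞(T′.arch) · ∏_{v ∈ T′.S ∪ S ∪ T} Tr Π_v(T′.loc v)` (★ FILE 3d `tr_eq_of_isTest`, any finite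
set `⊇ T′.S ∪ ram Π`).  With `T′.loc v = (f′_{S,∞} ⊗ f^S)_v ∘ ψ_v⁻¹`: at `v ∈ S` the factor is `Tr Π_v(f′_v ∘ ψ_v⁻¹)` (the finite part of ★ FILE 3f `trSψ`); at `v ∈ T = supp f^S`
it is `vol(K′_v) · t(Π)_v(f^S_v)` (★ FILE 3j, Satake); elsewhere `f_v = 𝟙_{K_v}` (pin level clause `ψ_v(K′_v) = K_v`) and `Tr Π_v(𝟙_{K_v}) = 1` ((TF-1)).

References: [Rogawski1990] §14.6 p. 243, §13.7 p. 206, §14.2 pp. 232–233, §13.3 p. 203; [FlathCorvallis1979] Thm. 3; [CartierCorvallis1979] §IV.1 Cor. 4.1.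
-/

set_option autoImplicit false
-- the mandated namespace repeats `HodgeConjecture.HodgeConjecture`, as in every `Theorems/*.lean` of this sub-problem
set_option linter.dupNamespace false

noncomputable section

open NumberField IsDedekindDomain MeasureTheory Filter
open scoped Matrix MatrixGroups

open Literature.NumberTheory Literature.NumberTheory.Automorphic Literature.NumberTheory.Automorphic.UnitaryGroup
open Literature.NumberTheory.Rogawski1990 Literature.NumberTheory.GaloisRepresentations
open Literature.RepresentationTheory.BorelWallach2000 Literature.RepresentationTheory.KonnoKonno2007
open Summit.HodgeConjecture.HodgeConjecture.Cruxes.H413.F0P3InnerFormClassificationV6 (TestG splitForm)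
open Summit.HodgeConjecture.HodgeConjecture.Cruxes.H413.F0P3LocalPacketKit
open Summit.HodgeConjecture.HodgeConjecture.Cruxes.H413.F0P3ArchPacketKit
open Summit.HodgeConjecture.HodgeConjecture.Cruxes.H413.F0P3SemilocalTestFunctionsOfRecord (TestS₀ toPureTensor locAll locAll_of_mem locAll_of_not_mem)
open Summit.HodgeConjecture.HodgeConjecture.Cruxes.H413.F0P3TestFunctionsOfRecord (Unr₀)

namespace Summit.HodgeConjecture.HodgeConjecture.Cruxes.H413.F0P3SpectralPacket

open Summit.HodgeConjecture.HodgeConjecture.Cruxes.H413.F0P3GlobalPacket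

variable {L : Type} [Field L] [NumberField L] [IsCMField L] {H : Matrix (Fin 3) (Fin 3) L} {ι : L →+* ℂ} {T : GL (Fin 3) ℂ}
  {hT : (T : Matrix (Fin 3) (Fin 3) ℂ)ᴴ * H.map ι * (T : Matrix (Fin 3) (Fin 3) ℂ) = Literature.Geometry.ComplexHyperbolic.BallModel.J}

/-! ## §1 The local factors of the record tensor `f′_{S,∞} ⊗ f^S` [§14.2 p. 233; §13.7 p. 206] -/

/-- Every local factor of `toPureTensor S fS fT` is `locAll fS fT v` (on `S ∪ T` by construction; elsewhere both are `𝟙_{K′_v}`). [cite: Rogawski1990, §14.2 p. 233] -/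
theorem toPureTensor_loc_eq_locAll (S : Finset (HeightOneSpectrum (𝓞 ↥(maximalRealSubfield L)))) (fS : TestS₀ L H ι T hT S) (fT : Unr₀ L H S)
    (v : HeightOneSpectrum (𝓞 ↥(maximalRealSubfield L))) : (toPureTensor S fS fT).loc v = locAll fS fT v := by
  classical
  by_cases hv : v ∈ S ∪ fT.T
  · exact UnitaryGroup.PureTensor.ofUnramified_loc_of_mem _ _ hv
  · have hvS : v ∉ S := fun h => hv (Finset.mem_union_left _ h)
    have hvT : v ∉ fT.T := fun h => hv (Finset.mem_union_right _ h)
    rw [(toPureTensor S fS fT).loc_eq_indicator v hv, locAll_of_not_mem fS fT hvS, fT.loc_eq v hvT]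
    rfl

namespace SpectralPacketG

variable {𝔩 : ∀ v : HeightOneSpectrum (𝓞 ↥(maximalRealSubfield L)), LocalPacketKit L (splitForm L 3) v} {𝔞 : ArchPacketKit}
  {μ : Measure (adelicGroupData (↥(maximalRealSubfield L)) L (IsCMField.complexConj L) 3 (splitForm L 3)).automorphicQuotient}
  [SMulInvariantMeasure (adelicGroupData (↥(maximalRealSubfield L)) L (IsCMField.complexConj L) 3 (splitForm L 3)).Adelic
    (adelicGroupData (↥(maximalRealSubfield L)) L (IsCMField.complexConj L) 3 (splitForm L 3)).automorphicQuotient μ]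
  [∀ v : HeightOneSpectrum (𝓞 ↥(maximalRealSubfield L)), MeasurableSpace ((cmDatum L 3 (splitForm L 3)).Local v)]
  [∀ v : HeightOneSpectrum (𝓞 ↥(maximalRealSubfield L)), BorelSpace ((cmDatum L 3 (splitForm L 3)).Local v)]
  [∀ v : HeightOneSpectrum (𝓞 ↥(maximalRealSubfield L)), MeasurableSpace ((cmDatum L 3 H).Local v)]
  [∀ v : HeightOneSpectrum (𝓞 ↥(maximalRealSubfield L)), BorelSpace ((cmDatum L 3 H).Local v)]
  {νG' : ∀ v : HeightOneSpectrum (𝓞 ↥(maximalRealSubfield L)), Measure ((cmDatum L 3 H).Local v)}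
  [∀ v, (νG' v).IsMulLeftInvariant] [∀ v, IsFiniteMeasureOnCompacts (νG' v)]
  {archTrG : GKIrrClass (uFormGroup (Fin 2) (Fin 1)) → (UnitaryGroup.arch (↥(maximalRealSubfield L)) L (IsCMField.complexConj L) 3 (splitForm L 3) → ℂ) → ℂ}

/-! ## §2 (P1)-G at the tuple: `Tr Π` of the pinned partner of `f′_{S,∞} ⊗ f^S` [§14.6 p. 243; §13.7 p. 206] -/

/-- **(P1)-G AT THE TUPLE, PRODUCT FORM**: for the record tensor `f′ = f′_{S,∞} ⊗ f^S` (`toPureTensor S fS fT`) and ANY smooth pure tensor `T′` on `G(𝔸)` with the pin (ix′) relation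
`T′.loc v = (toPureTensor S fS fT).loc v ∘ ψ_v⁻¹` at every finite `v` (the T1g-chosen partner `f = T′.eval`; ★ `IsPinned.transfer_tensors`), with `ram Π ∪ S₀ ⊆ S`:
`Tr Π(f) = Tr Π_∞(T′.arch) · (∏_{v ∈ S} Tr Π_v(f′_v ∘ ψ_v⁻¹)) · ∏_{v ∈ supp f^S} vol′(K′_v) · evpG Q v (f^S_v)`.
[cite: Rogawski1990, §14.6 p. 243; §13.7 p. 206; §14.2 pp. 232–233] [cite: FlathCorvallis1979, Thm. 3] [cite: CartierCorvallis1979, §IV.1 Cor. 4.1] -/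
theorem tr_partner_eq_prod (Q : SpectralPacketG 𝔩 𝔞 μ)
    (ψ : ∀ v : HeightOneSpectrum (𝓞 ↥(maximalRealSubfield L)), (cmDatum L 3 H).Local v ≃ₜ* (cmDatum L 3 (splitForm L 3)).Local v)
    (h1 : Q.fin.UnramTraceOne fun v => (νG' v).map (ψ v)) (hind : Q.PresentationIndep (fun v => (νG' v).map (ψ v)) archTrG)
    (h4 : ∀ v : HeightOneSpectrum (𝓞 ↥(maximalRealSubfield L)), (𝔩 v).UnramLaw)
    (hadm : ∀ (v : HeightOneSpectrum (𝓞 ↥(maximalRealSubfield L))), ∀ π ∈ (𝔩 v).mem (Q.fin.loc v), π.IsAdmissible)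
    (S₀ : Finset (HeightOneSpectrum (𝓞 ↥(maximalRealSubfield L))))
    (hgood : ∀ v ∉ S₀, ∀ r : SmoothIrrep ((UnitaryGroup.cmDatum L 3 (splitForm L 3)).Local v), r.ρ.IsAdmissible →
      Module.finrank ℂ (r.ρ.fixedPoints (cmLocalIntegralLevel L 3 (splitForm L 3) v)) ≤ 1)
    (hψK : ∀ v ∉ S₀, (cmLocalIntegralLevel L 3 H v).map (ψ v : (cmDatum L 3 H).Local v →* (cmDatum L 3 (splitForm L 3)).Local v) =
      cmLocalIntegralLevel L 3 (splitForm L 3) v)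
    (hμK : ∀ v : HeightOneSpectrum (𝓞 ↥(maximalRealSubfield L)), (νG' v).real (cmLocalIntegralLevel L 3 H v : Set ((cmDatum L 3 H).Local v)) ≠ 0)
    (S : Finset (HeightOneSpectrum (𝓞 ↥(maximalRealSubfield L)))) (hS₀ : S₀ ⊆ S) (hram : Q.fin.ramFinset ⊆ S)
    (fS : TestS₀ L H ι T hT S) (fT : Unr₀ L H S)
    {T' : UnitaryGroup.PureTensor L 3 (splitForm L 3)} (hT' : T'.IsTest)
    (hloc : ∀ v : HeightOneSpectrum (𝓞 ↥(maximalRealSubfield L)), T'.loc v = (toPureTensor S fS fT).loc v ∘ (ψ v).symm)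
    {F : TestG L} (hF : ⇑F = T'.eval) :
    Q.tr (fun v => (νG' v).map (ψ v)) archTrG F =
      𝔞.trPktInf archTrG Q.inf T'.arch *
        ((∏ v ∈ S, (𝔩 v).trPkt ((νG' v).map (ψ v)) (Q.fin.loc v) (locAll fS fT v ∘ (ψ v).symm)) *
          ∏ v ∈ fT.T, (((νG' v).real (cmLocalIntegralLevel L 3 H v : Set ((cmDatum L 3 H).Local v)) : ℂ) *
            Q.evpGψ ψ (fun w => (νG' w).map (ψ w)) v (fT.loc v))) := by
  classical
  have hloc' : ∀ v, T'.loc v = locAll fS fT v ∘ (ψ v).symm := fun v => by rw [hloc v, toPureTensor_loc_eq_locAll]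
  -- `Tr Π(f)` as the product over `T′.S ∪ (S ∪ T)`
  rw [Q.tr_eq_of_isTest hind h1 hT' hF (T'.S ∪ (S ∪ fT.T)) Finset.subset_union_left (fun v hv => Finset.mem_union_right _ (Finset.mem_union_left _ (hram hv)))]
  congr 1
  -- drop the places of `T′.S` outside `S ∪ T`: there `f_v = 𝟙_{K_v}` and `Tr Π_v(𝟙_{K_v}) = 1`
  rw [← Finset.prod_subset (Finset.subset_union_right : S ∪ fT.T ⊆ T'.S ∪ (S ∪ fT.T)) fun v _ hv => ?_]
  · rw [Finset.prod_union (Finset.disjoint_iff_ne.2 fun a ha b hb hab => Finset.disjoint_left.1 fT.hT hb (hab ▸ ha))]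
    congr 1
    · exact Finset.prod_congr rfl fun v _ => by rw [hloc' v]
    · refine Finset.prod_congr rfl fun v hv => ?_
      have hvS : v ∉ S := fun h => Finset.disjoint_left.1 fT.hT hv h
      rw [hloc' v, locAll_of_not_mem fS fT hvS, Q.evpGψ_eq_evpAtψ]
      exact Q.fin.trPkt_loc_comp_eq_measureReal_mul_evpAtψ ψ νG' (h4 v) (hadm v) (hgood v fun h => hvS (hS₀ h)) (hψK v fun h => hvS (hS₀ h))
        (hμK v) (fun h => hvS (hram h)) (fT.hcs v) (fT.hlev v)
  · have hvS : v ∉ S := fun h => hv (Finset.mem_union_left _ h)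
    have hvT : v ∉ fT.T := fun h => hv (Finset.mem_union_right _ h)
    rw [hloc' v, locAll_of_not_mem fS fT hvS, fT.loc_eq v hvT]
    -- `𝟙_{K′_v} ∘ ψ_v⁻¹ = 𝟙_{K_v}`
    have hind1 : (((cmLocalIntegralLevel L 3 H v : Set ((cmDatum L 3 H).Local v)).indicator fun _ => (1 : ℂ)) ∘ (ψ v).symm) =
        (cmLocalIntegralLevel L 3 (splitForm L 3) v : Set ((cmDatum L 3 (splitForm L 3)).Local v)).indicator fun _ => 1 := by
      funext g
      simp only [Function.comp_apply]
      rw [← hψK v fun h => hvS (hS₀ h)]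
      by_cases hg : (ψ v).symm g ∈ (cmLocalIntegralLevel L 3 H v : Set ((cmDatum L 3 H).Local v))
      · rw [Set.indicator_of_mem hg, Set.indicator_of_mem]
        exact ⟨(ψ v).symm g, hg, (ψ v).apply_symm_apply g⟩
      · rw [Set.indicator_of_notMem hg, Set.indicator_of_notMem]
        rintro ⟨k, hk, hkg⟩
        exact hg (by rw [← hkg]; simpa using hk)
    rw [hind1]
    exact h1 v (Q.fin.unr_of_not_mem_ramFinset fun h => hvS (hram h))

/-- **(P1)-G AT THE TUPLE, MODULO THE ARCHIMEDEAN IDENTITY** (letter N8 read at the packet: `Tr Π_∞` of the inner transfer `T′.arch` of `f′_∞` with the `U(2,1)`-characters equals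
`Tr Π_∞(f′_∞)` with the compact-side characters `archTr′`): `Tr Π(f) = trGS S Q f′_{S,∞} · ∏_{v ∈ supp f^S} vol′(K′_v) · evpG Q v (f^S_v)` — the (P1) clause's shape with
`hat f^S (t(Π))` spelled as the Satake product (★ FILE 3f `trSψ` is the tuple's `trGS`). [cite: Rogawski1990, §14.6 p. 243; §13.7 p. 206] [cite: FlathCorvallis1979, Thm. 3] -/
theorem tr_partner_eq_trSψ_mul_prod (Q : SpectralPacketG 𝔩 𝔞 μ)
    (ψ : ∀ v : HeightOneSpectrum (𝓞 ↥(maximalRealSubfield L)), (cmDatum L 3 H).Local v ≃ₜ* (cmDatum L 3 (splitForm L 3)).Local v)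
    (h1 : Q.fin.UnramTraceOne fun v => (νG' v).map (ψ v)) (hind : Q.PresentationIndep (fun v => (νG' v).map (ψ v)) archTrG)
    (h4 : ∀ v : HeightOneSpectrum (𝓞 ↥(maximalRealSubfield L)), (𝔩 v).UnramLaw)
    (hadm : ∀ (v : HeightOneSpectrum (𝓞 ↥(maximalRealSubfield L))), ∀ π ∈ (𝔩 v).mem (Q.fin.loc v), π.IsAdmissible)
    (S₀ : Finset (HeightOneSpectrum (𝓞 ↥(maximalRealSubfield L))))
    (hgood : ∀ v ∉ S₀, ∀ r : SmoothIrrep ((UnitaryGroup.cmDatum L 3 (splitForm L 3)).Local v), r.ρ.IsAdmissible →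
      Module.finrank ℂ (r.ρ.fixedPoints (cmLocalIntegralLevel L 3 (splitForm L 3) v)) ≤ 1)
    (hψK : ∀ v ∉ S₀, (cmLocalIntegralLevel L 3 H v).map (ψ v : (cmDatum L 3 H).Local v →* (cmDatum L 3 (splitForm L 3)).Local v) =
      cmLocalIntegralLevel L 3 (splitForm L 3) v)
    (hμK : ∀ v : HeightOneSpectrum (𝓞 ↥(maximalRealSubfield L)), (νG' v).real (cmLocalIntegralLevel L 3 H v : Set ((cmDatum L 3 H).Local v)) ≠ 0)
    (S : Finset (HeightOneSpectrum (𝓞 ↥(maximalRealSubfield L)))) (hS₀ : S₀ ⊆ S) (hram : Q.fin.ramFinset ⊆ S)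
    (fS : TestS₀ L H ι T hT S) (fT : Unr₀ L H S)
    {T' : UnitaryGroup.PureTensor L 3 (splitForm L 3)} (hT' : T'.IsTest)
    (hloc : ∀ v : HeightOneSpectrum (𝓞 ↥(maximalRealSubfield L)), T'.loc v = (toPureTensor S fS fT).loc v ∘ (ψ v).symm)
    {F : TestG L} (hF : ⇑F = T'.eval)
    (archTr' : GKIrrClass (uFormGroup (Fin 2) (Fin 1)) → (UnitaryGroup.arch (↥(maximalRealSubfield L)) L (IsCMField.complexConj L) 3 H → ℂ) → ℂ)
    (harchId : 𝔞.trPktInf archTrG Q.inf T'.arch = 𝔞.trPktInf archTr' Q.inf fS.arch) :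
    Q.tr (fun v => (νG' v).map (ψ v)) archTrG F =
      Q.trSψ ψ S (fun v => (νG' v).map (ψ v)) archTr' fS *
        ∏ v ∈ fT.T, (((νG' v).real (cmLocalIntegralLevel L 3 H v : Set ((cmDatum L 3 H).Local v)) : ℂ) * Q.evpGψ ψ (fun w => (νG' w).map (ψ w)) v (fT.loc v)) := by
  rw [Q.tr_partner_eq_prod ψ h1 hind h4 hadm S₀ hgood hψK hμK S hS₀ hram fS fT hT' hloc hF, harchId, Q.trSψ_eq, mul_assoc]
  congr 2
  rw [← Finset.prod_coe_sort S]
  exact Finset.prod_congr rfl fun v _ => by rw [locAll_of_mem fS fT v.2]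

end SpectralPacketG

end Summit.HodgeConjecture.HodgeConjecture.Cruxes.H413.F0P3SpectralPacket

end
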